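import Summits.QuantumFields.YangMills.Theorems.FlatTubeReductionPinnedOfNearFlat
import Summits.QuantumFields.YangMills.Theorems.FlatTubeReductionNearFlatRatioLaw
import HarnessLib

/-!
# Crux K1a′ `PinnedTubeRatioLawW` of route `FlatTubeReduction` (stmt-QuantumFields-27141, aside) — closed from the PROVED crux K1 `NearFlatRatioLaw`
# (route `FlatTubeReduction`; seat `ym-line-ftr-p1` g20; R2b1 RECORD rung — a fixed-lattice semiclassical statement; no summit statement is proved here)

K1a′ is K1's ratio law restricted to `L ≥ 2` and to Polyakov-PINNED tube states (one extra hypothesis), so K1 ⇒ K1a′ by discarding that hypothesis: the landed glue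
✓`FlatTubeReduction.pinnedTubeRatioLawW_of_nearFlatRatioLaw` (p629596) applied to ✓`FlatTubeReduction.nearFlatRatioLaw_proof` (`Theorems/FlatTubeReductionNearFlatRatioLaw.lean`,
line «ratepack_v2» of crux K1).  This is exactly the registered skeleton «via-k1» of the item (`Cruxes/PinnedTubeRatioLawW/Lines/via_k1.lean`) with its one stub discharged.
★★★ `FlatTubeReduction.pinnedTubeRatioLawW_proof : Summit.QuantumFields.YangMills.Theses.FlatTubeReduction.PinnedTubeRatioLawW`.
HONEST FRAMING: fixed-lattice (every `L ≥ 2`, eventually in `β`); R2b1 is a RECORD rung; NOT infinite volume, NOT a mass gap, NOT Clay; no summit statement is proved here.  No `sorry`.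
-/

set_option autoImplicit false

namespace Summit.QuantumFields.YangMills.Theorems.FlatTubeReduction

/-- ★★★ **Crux K1a′ `PinnedTubeRatioLawW` BY NAME**, from the proved crux K1 by the landed glue `pinnedTubeRatioLawW_of_nearFlatRatioLaw`. [cite: Luscher1983, §3] -/
theorem pinnedTubeRatioLawW_proof : Summit.QuantumFields.YangMills.Theses.FlatTubeReduction.PinnedTubeRatioLawW :=
  pinnedTubeRatioLawW_of_nearFlatRatioLaw nearFlatRatioLaw_proof

end Summit.QuantumFields.YangMills.Theorems.FlatTubeReduction
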